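import Summits.QuantumAdvantage.QuantumAdvantage.Theses.CubicForrelation
import Summits.QuantumAdvantage.QuantumAdvantage.Theorems.ExactPairsMaioranaMcFarland.Negative.DillonCertificate
import Literature.Computability.QuantumComplexity.ForrelationDerivativeTables

/-!
# Crux `CubicForrelation.ExactPairsMaioranaMcFarland` (stmt-QuantumAdvantage-2205) — line `two-adic-local-nongeneric`

Crux (verbatim shape, `n = m + m`): `∀ m f g, f cubic → g cubic → forrelation f g = 1 → g ∘ e = y′·perm(y″) + h(y″)`
for an affine bijection `e` — an exactly forrelated CUBIC pair (g bent with dual f, BOTH of degree ≤ 3) has `g` in the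
completed Maiorana–McFarland class.

## The line (crux idea `two-adic-local-nongeneric`, ideator 2, round 1; triage r1: pass ×3)

LEVER (two-adic reading of "the dual is cubic").  For a bent `g` on `𝔽₂^{2m}` with dual `f` and a `(2m−4)`-flat
`A = a + E`, Carlet's flat identity `Σ_{x∈a+E} (−1)^{g(x)} = 2^{m−4} Σ_{y∈E^⊥} (−1)^{f(y)+a·y}` turns
"`deg f ≤ 3`" (⇔ `f` has even weight on every 4-dimensional subspace) into the purely LOCAL, purely 2-ADIC statement
    `2^{m−3} ∣ wt(g|_A)` for every `(2m−4)`-flat `A`                                    (`stub_two_adic_flats`)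
i.e. every codimension-4 restriction of `g` has the weight divisibility of a QUADRATIC function (McEliece: weights in
RM(2,2m−4) are multiples of `2^{m−3}`, one bit more than Ax's bound gives a cubic for m = 5,6,7, two bits more from
m = 8 on).  At `m = 5` this is "every 6-section of the cubic form `T_g` is NON-GENERIC" (`wt ≡ 0 mod 4` on an
RM(3,6)/RM(2,6)-coset ⇔ `T|_S ∉ {e₁₂₃+e₄₅₆ split, non-split}` ⇔ `T|_S` has a 3-dimensional singular subspace;
triage F1/L3/M7: 0 mismatches in 12 800 + 1 680 cross-checks; F1 even identifies the quartic part of the dual with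
`⋆T^{[2]}`).  The line then runs LOCAL → GLOBAL on the trilinear form and finishes with Dillon:

* `stub_dual_of_forrelation` — `forrelation f g = 1` ⇒ `W_g(b) = 2^m (−1)^{f(b)}` for all `b` (Parseval +
  Cauchy–Schwarz equality; the tree's `DerivativeWalsh.W`).  Bridge from the crux's hypothesis to bent/dual form.
* `stub_two_adic_flats` — criterion D, necessity: `f` cubic, `g` bent with dual `f` ⇒ `2^{m−3} ∣ wt(g|_{a+E})` for
  every xor-closed `E` with `|E| = 2^{2m−4}` and every `a` (USES "f cubic": honours `Disproof.…_false_without_fCubic`,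
  whose witness `h¹⁰₄` has 46–49 % generic 6-sections).
* `stub_local_to_global` — LOAD-BEARING, NEW: `g` cubic and bent, all codim-4 flats 2-adically quadratic ⇒ the cubic
  form of `g` has an `m`-dimensional SINGULAR subspace `V` (all second derivatives `D_aD_b g`, `a b ∈ V`, CONSTANT;
  "relaxed M-subspace", rind = m).  First target inside it (m = 5, pure algebra): a bent-completable
  `T ∈ Λ³(𝔽₂¹⁰)*` all of whose 6-sections have a 3-dim singular subspace has a 5-dim singular subspace.
  (USES "g cubic": honours `…_false_without_gCubic`.)
* `stub_defect_vanishing` — the β-half: for an exact cubic pair with rind = m, the alternating DEFECT FORM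
  `c(a,b) = D_aD_b g (≡ const on a singular V)` can be killed: some `m`-dim `V′` has `D_aD_b g ≡ 0` (ind = m, Dillon's
  criterion).  (USES both degree bounds and exact duality.)
* `stub_dillon_normal_form` — Dillon 1974: a bent `g` affine on every coset of an `m`-dim subspace is, after a linear
  change of variables, `y′·perm(y″) + h(y″)` with `perm` a PERMUTATION (bentness) — literally the crux's conclusion.

Composition `ExactPairsMaioranaMcFarland_of` is five lines of logic (sorry-free) and concludes the crux BY NAME.
Every stub is implied by (crux + known theorems): 1, 2, 5 are theorems in print; 3 ⇐ crux + criterion-D sufficiency;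
4 ⇐ crux.  So the skeleton is sound relative to the crux; its bet is that 3 and 4 are EASIER than the crux because
3 is a statement about ONE cubic bent function's trilinear form under a local 2-adic hypothesis (no dual, no MM
normal form) and 4 starts from a singular half-space.  Small m: all stubs are classical for m ≤ 4 (m ≤ 2 trivial,
m = 3 Rothaus, m = 4 Hou 1998 / Braeken 2006 classification + the Boura–Canteaut inverse-degree parity); the open
content is m ≥ 5.

All five stubs are DEFINITION-FREE (only `forrelation`, `signOf`, `DerivativeWalsh.W`, the abbrev `bxor`,
`MvPolynomial`, `Finset`): subspaces are xor-closed finsets of cardinality `2^k`, flats are `a ⊕ E`, second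
derivatives are written out as 4-fold xors.
-/

set_option linter.dupNamespace false -- D-0017: single-problem summit ⇒ `QuantumAdvantage.QuantumAdvantage` by design

namespace Summit.QuantumAdvantage.QuantumAdvantage.Cruxes.ExactPairsMaioranaMcFarland.TwoAdicLocalNongeneric

open Literature.Computability.QuantumComplexity
open Literature.Computability.QuantumComplexity.BuzetChailloux (bxor)

/-! ## Registered stubs (5, definition-free) -/

/-- **stub_dual_of_forrelation** (bridge; known — Parseval `Σ_b W_g(b)² = 2^{4m}` + Cauchy–Schwarz equality:
`Σ_b (W_g(b) − 2^m (−1)^{f(b)})² = 0`).  `forrelation f g = 1` on `m + m` bits forces `g` to be BENT with dual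
exactly `f`: `W_g(b) = Σ_x (−1)^{g(x) + x·b} = 2^m (−1)^{f(b)}` for every `b`.  Size S–M.
Leans on: `forrelation`, `DerivativeWalsh.W`, `DerivativeWalsh.fsum_eq_sum_mul_W`, `Simon.sum_twist` (Parseval). -/
theorem stub_dual_of_forrelation :
    ∀ (m : ℕ) (f g : (Fin (m + m) → Bool) → Bool), forrelation f g = 1 →
      ∀ b : Fin (m + m) → Bool,
        DerivativeWalsh.W (fun x => signOf (g x)) b = (2 : ℝ) ^ m * signOf (f b) := by
  sorry

/-- **stub_two_adic_flats** (criterion D, necessity; known in substance — Carlet's flat identity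
`Σ_{x ∈ a+E} (−1)^{g(x)} = 2^{dim E − m} Σ_{y ∈ E^⊥} (−1)^{f(y) + a·y}` for a bent `g` with dual `f`, plus
"`deg f ≤ 3` ⇒ `f + a·y` has even weight on the 4-dimensional space `E^⊥`").  If the dual `f` is CUBIC then every
codimension-4 flat of `g` is 2-adically quadratic: `2^{m−3} ∣ #{x ∈ E : g(a ⊕ x) = 1}` for every xor-closed
`E ⊆ 𝔽₂^{2m}` with `|E| = 2^{2m−4}` and every translation `a` (vacuous for `m ≤ 3`; parity for `m = 4`; the
`q₆ = 0` / non-generic-6-section condition for `m = 5`).  Uses "f cubic" — the hypothesis PP20's `h¹⁰₄` violates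
(`Disproof.exactPairsMaioranaMcFarland_false_without_fCubic`).  Size M–L (Poisson summation over 𝔽₂-subspaces given
as xor-closed finsets; ANF degree ↔ 4-flat parities for `MvPolynomial` over `ZMod 2`; 2-adic bookkeeping).
Leans on: `DerivativeWalsh.W`, `Simon.sum_twist`, `Simon.twist_xor_left`, `MvPolynomial.totalDegree`. -/
theorem stub_two_adic_flats :
    ∀ (m : ℕ) (f g : (Fin (m + m) → Bool) → Bool),
      (∃ p : MvPolynomial (Fin (m + m)) (ZMod 2), p.totalDegree ≤ 3 ∧
        ∀ x, f x = decide (MvPolynomial.eval (fun j => if x j then (1 : ZMod 2) else 0) p = 1)) →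
      (∀ b : Fin (m + m) → Bool,
        DerivativeWalsh.W (fun x => signOf (g x)) b = (2 : ℝ) ^ m * signOf (f b)) →
      ∀ E : Finset (Fin (m + m) → Bool), (∀ a ∈ E, ∀ b ∈ E, bxor a b ∈ E) →
        E.card = 2 ^ (m + m - 4) →
        ∀ a : Fin (m + m) → Bool, 2 ^ (m - 3) ∣ (E.filter fun x => g (bxor a x) = true).card := by
  sorry

/-- **stub_local_to_global** (LOAD-BEARING, NEW — the local-to-global step of the idea).  A CUBIC bent `g` on
`𝔽₂^{2m}` all of whose codimension-4 flats are 2-adically quadratic (`2^{m−3} ∣ wt(g|_{a⊕E})`) has an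
`m`-dimensional SINGULAR subspace of its cubic form: an xor-closed `V`, `|V| = 2^m`, on which every second
derivative `D_aD_b g` (`a b ∈ V`) is CONSTANT (`T_g(a,b,·) = 0`; "relaxed M-subspace", rind g = m).
Why plausible: implied by the crux (+ criterion-D sufficiency); holds for m ≤ 4 by classification; all known cubic
bent functions outside MM# (PP20 `h¹⁰₃`, `h¹⁰₄`, the 765 Carlet-move outsiders, PPKZ Ex. 4) have rind = 4 < 5 AND
violate the hypothesis (quartic duals; 28–49 % generic 6-sections, triage L3); 0 generic sections among cubic-dual
functions (triage T2, 16 × 600).  First target (m = 5, pure trilinear algebra, attackable by cdisprove without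
bentness): `T ∈ Λ³(𝔽₂¹⁰)*` bent-completable with every 6-section non-generic ⇒ `T` has a 5-dim singular subspace;
immediate when `dim Rad T ≥ 4`.  Why it might fail: a bent-completable trivector with all 6-sections degenerate but
Witt-type index 4 (none known).  Size XL.  Uses "g cubic" (`Disproof.…_false_without_gCubic`: the quartic `f4` is
excluded).  Leans on: nothing beyond the tree's `bxor`/`DerivativeWalsh.W`; Hou's GL(6,2)-orbits of Λ³𝔽₂⁶ for m = 5. -/
theorem stub_local_to_global :
    ∀ (m : ℕ) (f g : (Fin (m + m) → Bool) → Bool),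
      (∃ p : MvPolynomial (Fin (m + m)) (ZMod 2), p.totalDegree ≤ 3 ∧
        ∀ x, g x = decide (MvPolynomial.eval (fun j => if x j then (1 : ZMod 2) else 0) p = 1)) →
      (∀ b : Fin (m + m) → Bool,
        DerivativeWalsh.W (fun x => signOf (g x)) b = (2 : ℝ) ^ m * signOf (f b)) →
      (∀ E : Finset (Fin (m + m) → Bool), (∀ a ∈ E, ∀ b ∈ E, bxor a b ∈ E) →
        E.card = 2 ^ (m + m - 4) →
        ∀ a : Fin (m + m) → Bool, 2 ^ (m - 3) ∣ (E.filter fun x => g (bxor a x) = true).card) →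
      ∃ V : Finset (Fin (m + m) → Bool), (∀ a ∈ V, ∀ b ∈ V, bxor a b ∈ V) ∧ V.card = 2 ^ m ∧
        ∀ a ∈ V, ∀ b ∈ V, ∀ x y : Fin (m + m) → Bool,
          (g x ^^ g (bxor x a) ^^ g (bxor x b) ^^ g (bxor (bxor x a) b)) =
            (g y ^^ g (bxor y a) ^^ g (bxor y b) ^^ g (bxor (bxor y a) b)) := by
  sorry

/-- **stub_defect_vanishing** (the β-half / DEFECT FORM).  For an exact cubic pair (`f`, `g` cubic, `g` bent with
dual `f`) that already has an `m`-dimensional singular subspace `V` of the cubic form (second derivatives constant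
on `V × V`), the alternating bilinear defect form `c(a,b) := D_aD_b g ∈ 𝔽₂` can be killed: there is an
`m`-dimensional xor-closed `V′` with `D_aD_b g ≡ 0` for all `a b ∈ V′` — Dillon's criterion (ind g = m).
Why plausible: implied by the crux; on every cubic/cubic pair generated so far (MM with linear / triangular
biquadratic / involutive π, direct sums, Carlet-walked, Gold-type `F₈×F₈`; ≈ 600 k instances over four refuter
passes and three triages) Dillon subspaces exist and even abound (≥ 7 per instance, triage M1); Carlet moves
`g ↦ g ⊕ ℓ_aℓ_b` fix `T_g` and shift `β` by `a∧b`, so `V′` may be sought inside the Lagrangian family of `T_g`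
(triage-3 structural remark S2; move-homotopy's C1 is the natural sub-lemma).  Why it might fail: a cubic-dual bent
completion of a cubic form with `Lag_m(T) ≠ ∅` none of whose singular m-spaces carries a vanishing defect — would
itself refute the crux.  Size L–XL.  Uses both degree bounds and exact duality (all three `_false_without_` items).
Leans on: `bxor`, `DerivativeWalsh.W`; derivative duality `W_{D_a g}(c) = W_{D_c f}(a)` (tree:
`DerivativeWalsh.dwt_transpose_of_forrelation_sq_eq_one`). -/
theorem stub_defect_vanishing :
    ∀ (m : ℕ) (f g : (Fin (m + m) → Bool) → Bool),
      (∃ p : MvPolynomial (Fin (m + m)) (ZMod 2), p.totalDegree ≤ 3 ∧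
        ∀ x, f x = decide (MvPolynomial.eval (fun j => if x j then (1 : ZMod 2) else 0) p = 1)) →
      (∃ p : MvPolynomial (Fin (m + m)) (ZMod 2), p.totalDegree ≤ 3 ∧
        ∀ x, g x = decide (MvPolynomial.eval (fun j => if x j then (1 : ZMod 2) else 0) p = 1)) →
      (∀ b : Fin (m + m) → Bool,
        DerivativeWalsh.W (fun x => signOf (g x)) b = (2 : ℝ) ^ m * signOf (f b)) →
      (∃ V : Finset (Fin (m + m) → Bool), (∀ a ∈ V, ∀ b ∈ V, bxor a b ∈ V) ∧ V.card = 2 ^ m ∧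
        ∀ a ∈ V, ∀ b ∈ V, ∀ x y : Fin (m + m) → Bool,
          (g x ^^ g (bxor x a) ^^ g (bxor x b) ^^ g (bxor (bxor x a) b)) =
            (g y ^^ g (bxor y a) ^^ g (bxor y b) ^^ g (bxor (bxor y a) b))) →
      ∃ V : Finset (Fin (m + m) → Bool), (∀ a ∈ V, ∀ b ∈ V, bxor a b ∈ V) ∧ V.card = 2 ^ m ∧
        ∀ a ∈ V, ∀ b ∈ V, ∀ x : Fin (m + m) → Bool,
          (g x ^^ g (bxor x a) ^^ g (bxor x b) ^^ g (bxor (bxor x a) b)) = false := by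
  sorry

/-- **stub_dillon_normal_form** (Dillon 1974 / Carlet 2020 Prop. on class M: known, never formalised).  A bent `g`
(`W_g = ±2^m`, dual `f`) that is affine on every coset of an `m`-dimensional subspace `V` (`D_aD_b g ≡ 0` for
`a b ∈ V`) is in the completed Maiorana–McFarland class in the crux's OWN normal form: a linear (a fortiori affine)
bijection `e` straightening `V` to the `y′`-block gives `g(e(y′,y″)) = y′·perm(y″) + h(y″)`, and bentness makes
`perm` a permutation of `𝔽₂^m`.  Conclusion = the crux's conclusion verbatim (= `Negative.MMConclusionAt m g`).
Size M–L (xor-closed finset of size `2^m` ⇒ `m`-dim `ZMod 2`-subspace ⇒ adapted basis ⇒ `Matrix` witness; Walsh sum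
of an MM form).  Leans on: `Module.finrank`, `Basis.extend`-type API over `ZMod 2`, `DerivativeWalsh.W`. -/
theorem stub_dillon_normal_form :
    ∀ (m : ℕ) (f g : (Fin (m + m) → Bool) → Bool),
      (∀ b : Fin (m + m) → Bool,
        DerivativeWalsh.W (fun x => signOf (g x)) b = (2 : ℝ) ^ m * signOf (f b)) →
      (∃ V : Finset (Fin (m + m) → Bool), (∀ a ∈ V, ∀ b ∈ V, bxor a b ∈ V) ∧ V.card = 2 ^ m ∧
        ∀ a ∈ V, ∀ b ∈ V, ∀ x : Fin (m + m) → Bool,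
          (g x ^^ g (bxor x a) ^^ g (bxor x b) ^^ g (bxor (bxor x a) b)) = false) →
      ∃ e : (Fin (m + m) → Bool) ≃ (Fin (m + m) → Bool),
        (∃ M : Matrix (Fin (m + m)) (Fin (m + m)) (ZMod 2), ∃ c : Fin (m + m) → ZMod 2,
          ∀ y i, (if e y i then (1 : ZMod 2) else 0) =
            (M.mulVec (fun j => if y j then (1 : ZMod 2) else 0) + c) i) ∧
        ∃ perm : (Fin m → Bool) ≃ (Fin m → Bool), ∃ h : (Fin m → Bool) → Bool,
          ∀ y' y'' : Fin m → Bool,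
            (if g (e (Fin.append y' y'')) then (1 : ZMod 2) else 0) =
              (∑ i, (if y' i then (1 : ZMod 2) else 0) * (if perm y'' i then (1 : ZMod 2) else 0)) +
                (if h y'' then (1 : ZMod 2) else 0) := by
  sorry

/-! ## Composition (sorry-free): the five stub STATEMENTS imply the crux BY NAME -/

/-- bridge → two-adic flats → singular half-space → vanishing defect → Dillon normal form ⇒
`CubicForrelation.ExactPairsMaioranaMcFarland` (stmt-QuantumAdvantage-2205).  Pure logic over the stub statements. -/
theorem ExactPairsMaioranaMcFarland_of :
    type_of% stub_dual_of_forrelation → type_of% stub_two_adic_flats → type_of% stub_local_to_global →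
      type_of% stub_defect_vanishing → type_of% stub_dillon_normal_form →
        Summit.QuantumAdvantage.QuantumAdvantage.Theses.CubicForrelation.ExactPairsMaioranaMcFarland := by
  intro h1 h2 h3 h4 h5
  rw [Summit.QuantumAdvantage.QuantumAdvantage.Theorems.ExactPairsMaioranaMcFarland.Negative.exactPairsMaioranaMcFarland_iff]
  intro m f g hf hg hΦ
  have hW := h1 m f g hΦ
  exact h5 m f g hW (h4 m f g hf hg hW (h3 m f g hg hW (h2 m f g hf hW)))

/-- The skeleton with its (sorried) stubs plugged in: the crux by name. -/
theorem ExactPairsMaioranaMcFarland_of_stubs :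
    Summit.QuantumAdvantage.QuantumAdvantage.Theses.CubicForrelation.ExactPairsMaioranaMcFarland :=
  ExactPairsMaioranaMcFarland_of stub_dual_of_forrelation stub_two_adic_flats stub_local_to_global
    stub_defect_vanishing stub_dillon_normal_form

/-! ## Sanity (sorry-free): the last stub's conclusion is literally the landed `Negative.MMConclusionAt` -/

example (m : ℕ) (g : (Fin (m + m) → Bool) → Bool) :
    Summit.QuantumAdvantage.QuantumAdvantage.Theorems.ExactPairsMaioranaMcFarland.Negative.MMConclusionAt m g ↔
      ∃ e : (Fin (m + m) → Bool) ≃ (Fin (m + m) → Bool),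
        (∃ M : Matrix (Fin (m + m)) (Fin (m + m)) (ZMod 2), ∃ c : Fin (m + m) → ZMod 2,
          ∀ y i, (if e y i then (1 : ZMod 2) else 0) =
            (M.mulVec (fun j => if y j then (1 : ZMod 2) else 0) + c) i) ∧
        ∃ perm : (Fin m → Bool) ≃ (Fin m → Bool), ∃ h : (Fin m → Bool) → Bool,
          ∀ y' y'' : Fin m → Bool,
            (if g (e (Fin.append y' y'')) then (1 : ZMod 2) else 0) =
              (∑ i, (if y' i then (1 : ZMod 2) else 0) * (if perm y'' i then (1 : ZMod 2) else 0)) +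
                (if h y'' then (1 : ZMod 2) else 0) :=
  Iff.rfl

end Summit.QuantumAdvantage.QuantumAdvantage.Cruxes.ExactPairsMaioranaMcFarland.TwoAdicLocalNongeneric
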